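import Literature.AnabelianGeometry.SemiGraphs.UniformSplittingProofs
import Literature.AnabelianGeometry.SemiGraphs.BTempPointFibres
import Literature.AnabelianGeometry.SemiGraphs.TemperedChartTransport
import Literature.AnabelianGeometry.SemiGraphs.TemperedMaximalCompact
import HarnessLib

/-!
# Verticial subgroups of a covering semi-graph of anabelioids (dictionary)

Mochizuki, *Semi-graphs of anabelioids*, Publ. RIMS **42** (2006), §3: Proposition 3.6 (v) p. 39
(`B^temp(G_S) ≌ B^temp(G)_S` for a tempered covering `S` of a coherent `G` as in Prop. 3.6) and
Theorem 3.7 (i)/(iii) pp. 40–41 (verticial subgroups "`π̂₁(G_v) ↪ π₁^temp(G)`", edge-like subgroups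
"images of `π̂₁(G_e)`") [cite: MochizukiSemiAnbd2006, Prop 3.6(v) p.39].  For the covering semi-graph
of anabelioids `G_S → G` (`CovObj.coveringGraph`: the vertex over `v` indexed by the `Π_v`-orbit `ω`
of `S_v` carries the anabelioid of the STABILISER `Stab_{Π_v}(s_ω)`), this file computes the
restriction functors `B^temp(G_S) → B^temp(Π_{(v,ω)})` through the étale equivalence of Prop. 3.6 (v)
and a chart of `G`:

* `etaleEquiv_inverse_restrictV` — under `B^temp(G)_S ≌ B^temp(G_S)` the restriction to
  the vertex `(v, ω)` is the POINT FIBRE at `s_ω = Quot.out ω` of the restriction to `v` (definitional);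
* `exists_isVerticialHom_normalised` — a verticial homomorphism
  `χ : Π_v → Π` of `G` may be conjugated so that the comparison isomorphism sends `s_ω` to the chosen base
  point `x₀` of the chart image `X_S` of `S`, without changing its image;
* `exists_ptFibre_compat` — then the point fibre at `s_ω` is `B^temp` of the
  restriction `ψ : Stab_{Π_v}(s_ω) → Stab_Π(x₀)` of `χ`, composed with the point fibre at `x₀` over `X_S`;
* `exists_isVerticialHom_coveringGraph` — hence, for ANY chart `c_S`
  of `G_S` identified with `Stab_Π(x₀)` through `φ` (route-T brick T1, `CovObj.exists_chartGroup_compatIso`),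
  `φ ∘ ψ` is a verticial homomorphism of `G_S` at `(v, ω)`: "the verticial subgroups of the covering
  graph are the traces on the open stabiliser of the verticial subgroups of `G`".

The edge-like twin is `CoveringGraphEdgeDictionary.lean`.  Proof-only (abc-iut cell, L3 route T
«(iii)/(iv) At transfer along tempered coverings», brick T2a; L3-lead ruling α42 (3)); nothing here bears
on [IUTchIII] Cor. 3.12.
-/

noncomputable section

open CategoryTheory CategoryTheory.Limits Topology

namespace Literature.AnabelianGeometry.SemiGraphs

open Literature.AlgebraicGeometry.Frobenioids.QuasiTemperoid.BTempConnected (hom_ρ hom_ext_apply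
  ρ_one_apply ρ_mul_apply ρ_inv_apply)
open GaloisObjects (iso_inv_hom_apply iso_hom_inv_apply)

namespace ProfiniteSemiGraph

namespace CovObj

universe u

variable {𝒢 : ProfiniteSemiGraph.{u}} (S : CovObj 𝒢)

/-! ### The restriction to a vertex of `G_S` is a point fibre (definitional) -/

/-- Under the étale equivalence `B^temp(G)_S ≌ B^temp(G_S)` of Prop. 3.6 (v), restriction to the vertex
`(v, ω)` of `G_S` is "restrict to `v`, then take the point fibre at `s_ω = Quot.out ω`" — by
construction of `CovObj.coveringEquiv`. [cite: MochizukiSemiAnbd2006, Prop 3.6(v) p.39] -/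
theorem etaleEquiv_inverse_restrictV (hU : UniformSplitting.{u}) (h36 : 𝒢.Prop36Hypotheses)
    (hcoh : 𝒢.IsCoherent) (hS : S.IsTempered) (v : 𝒢.graph.Vertex) (ω : BTemp.Orbits (S.SV v)) :
    (S.etaleEquiv hU h36 hcoh hS).inverse ⋙ ObjectProperty.ι _ ⋙
        restrictV S.coveringGraph (⟨v, ω⟩ : S.coveringGraph.graph.Vertex) =
      Over.post (ObjectProperty.ι _ ⋙ restrictV 𝒢 v) ⋙ BTemp.fibreFamily (S.SV v) ⋙
        Pi.eval (fun ω' => BTemp (BTemp.stab (S.SV v) (Quot.out ω'))) ω := rfl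

/-! ### Normalising a verticial homomorphism at the base points -/

/-- **Normalisation of a verticial homomorphism** (Prop. 3.2: verticial homomorphisms are defined up
to conjugation): given a verticial homomorphism `χ₀ : Π_v → Π` for the chart `c` and an orbit `ω₀` of
the chart image `X_S` of `S` with base point `x₀ = Quot.out ω₀`, there are an orbit `ω` of `S_v`, an
element `a ∈ Π_v` and the conjugate `χ = γ_{χ₀(a)}⁻¹ ∘ χ₀` (so `χ b = χ₀(a⁻¹ b a)`, same image) together
with an isomorphism `k : (restriction to v) ≅ (chart, then B^temp(χ))` whose component at `S` sends the
base point `s_ω = Quot.out ω` of `S_v` to `x₀`. [cite: MochizukiSemiAnbd2006, Thm 3.7(i) p.40] -/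
theorem exists_isVerticialHom_normalised (c : TemperedPiChart 𝒢) (hS : S.IsTempered)
    (ω₀ : BTemp.Orbits (c.equiv.functor.obj ⟨S, hS⟩)) (v : 𝒢.graph.Vertex) (χ₀ : 𝒢.Gv v →ₜ* c.G)
    (hχ₀ : IsVerticialHom c v χ₀) :
    ∃ (ω : BTemp.Orbits (S.SV v)) (a : 𝒢.Gv v) (χ : 𝒢.Gv v →ₜ* c.G)
      (k : ObjectProperty.ι _ ⋙ restrictV 𝒢 v ≅ c.equiv.functor ⋙ BTemp.res χ),
      (∀ b, χ b = χ₀ (a⁻¹ * b * a)) ∧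
      (k.hom.app ⟨S, hS⟩).hom.hom (Quot.out ω) = (Quot.out ω₀ : (c.equiv.functor.obj ⟨S, hS⟩).obj.V) := by
  haveI := c.isTopologicalGroup
  obtain ⟨j₀⟩ := hχ₀
  let X : BTemp c.G := c.equiv.functor.obj ⟨S, hS⟩
  let x₀ : X.obj.V := Quot.out ω₀
  let G₁ : BTempCat 𝒢 ⥤ BTemp (𝒢.Gv v) := ObjectProperty.ι _ ⋙ restrictV 𝒢 v
  -- `G₁ ≅ c.equiv.functor ⋙ B^temp(χ₀)`
  let k₀ : G₁ ≅ c.equiv.functor ⋙ BTemp.res χ₀ :=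
    (Functor.isoWhiskerRight c.equiv.unitIso G₁ : 𝟭 _ ⋙ G₁ ≅ (c.equiv.functor ⋙ c.equiv.inverse) ⋙ G₁) ≪≫
      (Functor.isoWhiskerLeft c.equiv.functor j₀ :
        c.equiv.functor ⋙ (c.equiv.inverse ⋙ G₁) ≅ c.equiv.functor ⋙ BTemp.res χ₀)
  -- the orbit of the preimage of `x₀`, its base point, and a translation in `Π_v`
  let s' : (S.SV v).obj.V := (k₀.inv.app ⟨S, hS⟩).hom.hom x₀
  let ω : BTemp.Orbits (S.SV v) := BTemp.cl (S.SV v) s'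
  let s : (S.SV v).obj.V := Quot.out ω
  obtain ⟨a, ha⟩ : ∃ a : 𝒢.Gv v, (S.SV v).obj.ρ a s' = s :=
    (BTemp.cl_eq_cl_iff (S.SV v) s' s).mp (by
      change BTemp.cl (S.SV v) s' = Quot.mk _ (Quot.out ω)
      rw [Quot.out_eq])
  -- `k₀` sends `s` to `χ₀(a) · x₀`
  have hk₀ : ((k₀.hom.app ⟨S, hS⟩).hom.hom s : X.obj.V) = X.obj.ρ (χ₀ a) x₀ := by
    rw [← ha]
    have e := hom_ρ (k₀.hom.app ⟨S, hS⟩) a s'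
    change (k₀.hom.app ⟨S, hS⟩).hom.hom ((S.SV v).obj.ρ a s') =
      X.obj.ρ (χ₀ a) ((k₀.hom.app ⟨S, hS⟩).hom.hom s') at e
    rw [e]
    congr 1
    exact iso_hom_inv_apply (k₀.app ⟨S, hS⟩) x₀
  -- conjugate `χ₀` by `χ₀(a)⁻¹`
  let g : c.G := χ₀ a
  let κ : c.G →ₜ* c.G :=
    { toMonoidHom := (MulAut.conj g⁻¹).toMonoidHom
      continuous_toFun := by
        change Continuous fun x => g⁻¹ * x * g⁻¹⁻¹
        fun_prop }
  let χ : 𝒢.Gv v →ₜ* c.G := κ.comp χ₀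
  have hχ : ∀ b, g⁻¹ * χ₀ b * g⁻¹⁻¹ = χ b := fun _ => rfl
  let r : BTemp.res χ₀ ≅ BTemp.res χ := BTemp.resIsoOfConj χ₀ χ g⁻¹ hχ
  refine ⟨ω, a, χ, k₀ ≪≫ Functor.isoWhiskerLeft c.equiv.functor r, fun b => ?_, ?_⟩
  · change g⁻¹ * χ₀ b * g⁻¹⁻¹ = χ₀ (a⁻¹ * b * a)
    rw [inv_inv, map_mul, map_mul, map_inv]
  · change ((r.hom.app X).hom.hom ((k₀.hom.app ⟨S, hS⟩).hom.hom s) : X.obj.V) = x₀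
    rw [BTemp.resIsoOfConj_hom_app_apply, hk₀]
    exact ρ_inv_apply X g x₀

/-! ### The point fibre at `s_ω` through the chart -/

/-- **The restriction of `χ` to the stabilisers computes the point fibre at `s_ω`**: given
`k : (restriction to v) ≅ (chart, then B^temp(χ))` sending `s_ω` to `x₀`, the restriction
`ψ : Stab_{Π_v}(s_ω) → Stab_Π(x₀)` of `χ` is defined, `Stab_{Π_v}(s_ω) = χ⁻¹(Stab_Π(x₀))`, and "point
fibre at `s_ω` after restriction to `v`" is isomorphic to "point fibre at `x₀` over `X_S` after the
chart, then `B^temp(ψ)`". [cite: MochizukiSemiAnbd2006, Prop 3.6(v) p.39] -/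
theorem exists_ptFibre_compat (c : TemperedPiChart 𝒢) (hS : S.IsTempered)
    (ω₀ : BTemp.Orbits (c.equiv.functor.obj ⟨S, hS⟩)) (v : 𝒢.graph.Vertex) (ω : BTemp.Orbits (S.SV v))
    (χ : 𝒢.Gv v →ₜ* c.G) (k : ObjectProperty.ι _ ⋙ restrictV 𝒢 v ≅ c.equiv.functor ⋙ BTemp.res χ)
    (hk : (k.hom.app ⟨S, hS⟩).hom.hom (Quot.out ω) = (Quot.out ω₀ : (c.equiv.functor.obj ⟨S, hS⟩).obj.V)) :
    ∃ ψ : BTemp.stab (S.SV v) (Quot.out ω) →ₜ* BTemp.stab (c.equiv.functor.obj ⟨S, hS⟩) (Quot.out ω₀),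
      (∀ h, ((ψ h : BTemp.stab (c.equiv.functor.obj ⟨S, hS⟩) (Quot.out ω₀)) : c.G) = χ (h : 𝒢.Gv v)) ∧
      (∀ b : 𝒢.Gv v, b ∈ BTemp.stab (S.SV v) (Quot.out ω) ↔
        χ b ∈ BTemp.stab (c.equiv.functor.obj ⟨S, hS⟩) (Quot.out ω₀)) ∧
      Nonempty (Over.post (ObjectProperty.ι _ ⋙ restrictV 𝒢 v) ⋙ BTemp.fibreFamily (S.SV v) ⋙
          Pi.eval (fun ω' => BTemp (BTemp.stab (S.SV v) (Quot.out ω'))) ω ≅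
        Over.post c.equiv.functor ⋙ BTemp.fibreFamily (c.equiv.functor.obj ⟨S, hS⟩) ⋙
          Pi.eval (fun ω' => BTemp (BTemp.stab (c.equiv.functor.obj ⟨S, hS⟩) (Quot.out ω'))) ω₀ ⋙
          BTemp.res ψ) := by
  haveI := c.isTopologicalGroup
  let X : BTemp c.G := c.equiv.functor.obj ⟨S, hS⟩
  let x₀ : X.obj.V := Quot.out ω₀
  let s : (S.SV v).obj.V := Quot.out ω
  let G₁ : BTempCat 𝒢 ⥤ BTemp (𝒢.Gv v) := ObjectProperty.ι _ ⋙ restrictV 𝒢 v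
  -- `Stab(s) = χ⁻¹(Stab(x₀))`
  have hiff : ∀ b : 𝒢.Gv v, b ∈ BTemp.stab (S.SV v) s ↔ χ b ∈ BTemp.stab X x₀ := by
    intro b
    have e := hom_ρ (k.hom.app ⟨S, hS⟩) b s
    change (k.hom.app ⟨S, hS⟩).hom.hom ((S.SV v).obj.ρ b s) =
      X.obj.ρ (χ b) ((k.hom.app ⟨S, hS⟩).hom.hom s) at e
    rw [show (k.hom.app ⟨S, hS⟩).hom.hom s = x₀ from hk] at e
    change (S.SV v).obj.ρ b s = s ↔ X.obj.ρ (χ b) x₀ = x₀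
    constructor
    · intro hb
      rw [hb, show (k.hom.app ⟨S, hS⟩).hom.hom s = x₀ from hk] at e
      exact e.symm
    · intro hb
      rw [hb, ← show (k.hom.app ⟨S, hS⟩).hom.hom s = x₀ from hk] at e
      have := congrArg (fun y => (k.inv.app ⟨S, hS⟩).hom.hom y) e
      have h1 := iso_inv_hom_apply (k.app ⟨S, hS⟩) ((S.SV v).obj.ρ b s)
      have h2 := iso_inv_hom_apply (k.app ⟨S, hS⟩) s
      change (k.inv.app ⟨S, hS⟩).hom.hom ((k.hom.app ⟨S, hS⟩).hom.hom ((S.SV v).obj.ρ b s)) = _ at h1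
      change (k.inv.app ⟨S, hS⟩).hom.hom ((k.hom.app ⟨S, hS⟩).hom.hom s) = _ at h2
      change (k.inv.app ⟨S, hS⟩).hom.hom ((k.hom.app ⟨S, hS⟩).hom.hom ((S.SV v).obj.ρ b s)) =
        (k.inv.app ⟨S, hS⟩).hom.hom ((k.hom.app ⟨S, hS⟩).hom.hom s) at this
      rwa [h1, h2] at this
  have hst : ∀ h : BTemp.stab (S.SV v) s, χ (h : 𝒢.Gv v) ∈ BTemp.stab X x₀ := fun h => (hiff h).mp h.2
  let ψ : BTemp.stab (S.SV v) s →ₜ* BTemp.stab X x₀ :=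
    { toFun := fun h => ⟨χ (h : 𝒢.Gv v), hst h⟩
      map_one' := Subtype.ext (map_one χ)
      map_mul' := fun a b => Subtype.ext (map_mul χ (a : 𝒢.Gv v) (b : 𝒢.Gv v))
      continuous_toFun := (χ.continuous.comp continuous_subtype_val).subtype_mk _ }
  refine ⟨ψ, fun _ => rfl, hiff, ⟨?_⟩⟩
  -- pointwise consequences of the naturality of `k`
  have nat : ∀ {A B : BTempCat 𝒢} (f : A ⟶ B) (t : (G₁.obj A).obj.V),
      ((k.hom.app B).hom.hom ((G₁.map f).hom.hom t) : (c.equiv.functor.obj B).obj.V) =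
        (c.equiv.functor.map f).hom.hom ((k.hom.app A).hom.hom t) := by
    intro A B f t
    have := congrArg (fun m => (m.hom.hom t : (c.equiv.functor.obj B).obj.V)) (k.hom.naturality f)
    rw [GaloisObjects.comp_apply, GaloisObjects.comp_apply] at this
    exact this
  have nat' : ∀ {A B : BTempCat 𝒢} (f : A ⟶ B) (t : (c.equiv.functor.obj A).obj.V),
      ((k.inv.app B).hom.hom ((c.equiv.functor.map f).hom.hom t) : (G₁.obj B).obj.V) =
        (G₁.map f).hom.hom ((k.inv.app A).hom.hom t) := by
    intro A B f t
    have := congrArg (fun m => (m.hom.hom t : (G₁.obj B).obj.V)) (k.inv.naturality f)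
    rw [GaloisObjects.comp_apply, GaloisObjects.comp_apply] at this
    exact this
  have hk' : (k.inv.app ⟨S, hS⟩).hom.hom x₀ = s := by
    have := iso_inv_hom_apply (k.app ⟨S, hS⟩) s
    change (k.inv.app ⟨S, hS⟩).hom.hom ((k.hom.app ⟨S, hS⟩).hom.hom s) = s at this
    rwa [show (k.hom.app ⟨S, hS⟩).hom.hom s = x₀ from hk] at this
  refine NatIso.ofComponents (fun T => ?_) ?_
  · refine
      { hom := BTemp.homOfEquivariant _ _
          (fun t => ⟨(k.hom.app T.left).hom.hom t.1, ?_⟩) ?_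
        inv := BTemp.homOfEquivariant _ _
          (fun t => ⟨(k.inv.app T.left).hom.hom t.1, ?_⟩) ?_
        hom_inv_id := ?_
        inv_hom_id := ?_ }
    · change ((c.equiv.functor.map T.hom).hom.hom ((k.hom.app T.left).hom.hom t.1) : X.obj.V) = x₀
      rw [← nat]
      have ht : (G₁.map T.hom).hom.hom t.1 = s := t.2
      rw [ht]
      exact hk
    · intro h t
      apply Subtype.ext
      change (k.hom.app T.left).hom.hom ((G₁.obj T.left).obj.ρ (h : 𝒢.Gv v) t.1) =
        (c.equiv.functor.obj T.left).obj.ρ (χ (h : 𝒢.Gv v)) ((k.hom.app T.left).hom.hom t.1)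
      rw [hom_ρ]
      rfl
    · change (G₁.map T.hom).hom.hom ((k.inv.app T.left).hom.hom t.1) = s
      rw [← nat']
      have ht : ((c.equiv.functor.map T.hom).hom.hom t.1 : X.obj.V) = x₀ := t.2
      rw [ht]
      exact hk'
    · intro h t
      apply Subtype.ext
      change (k.inv.app T.left).hom.hom ((c.equiv.functor.obj T.left).obj.ρ (χ (h : 𝒢.Gv v)) t.1) =
        (G₁.obj T.left).obj.ρ (h : 𝒢.Gv v) ((k.inv.app T.left).hom.hom t.1)
      exact hom_ρ (k.inv.app T.left) (h : 𝒢.Gv v) t.1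
    · apply hom_ext_apply
      intro t
      apply Subtype.ext
      exact iso_inv_hom_apply (k.app T.left) t.1
    · apply hom_ext_apply
      intro t
      apply Subtype.ext
      exact iso_hom_inv_apply (k.app T.left) t.1
  · intro T T' f
    apply hom_ext_apply
    intro t
    apply Subtype.ext
    exact nat f.left t.1

/-! ### Verticial homomorphisms of the covering graph -/

/-- **Verticial homomorphisms of `G_S` are restrictions of verticial homomorphisms of `G` to
stabilisers, read in the open stabiliser `Stab_Π(x₀) ≅ π₁^temp(G_S)`** ([SemiAnbd] Prop. 3.6 (v) with
Thm. 3.7 (i)): for a chart `c_S` of `G_S` identified with `Stab_Π(x₀)` through `φ` compatibly with the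
explicit equivalence `B^temp(π₁^temp(G_S)) ≌ B^temp(Stab_Π(x₀))` (route-T brick T1), a vertex `v` of `G`
and a verticial homomorphism `χ₀` at `v`, there are an orbit `ω` of `S_v`, a conjugate `χ` of `χ₀` by an
element of `χ₀(Π_v)` (same image) and its restriction `ψ : Stab_{Π_v}(s_ω) → Stab_Π(x₀)` with
`Stab_{Π_v}(s_ω) = χ⁻¹(Stab_Π(x₀))`, such that `φ ∘ ψ` is a verticial homomorphism of `G_S` at the vertex
`(v, ω)`. [cite: MochizukiSemiAnbd2006, Thm 3.7(i) p.40] -/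
theorem exists_isVerticialHom_coveringGraph (h36 : 𝒢.Prop36Hypotheses) (hcoh : 𝒢.IsCoherent)
    (c : TemperedPiChart 𝒢) (hS : S.IsTempered) (cS : TemperedPiChart S.coveringGraph)
    (ω₀ : BTemp.Orbits (c.equiv.functor.obj ⟨S, hS⟩))
    (φ : BTemp.stab (c.equiv.functor.obj ⟨S, hS⟩) (Quot.out ω₀) →ₜ* cS.G)
    (hφ : Nonempty (cS.equiv.inverse ⋙ (S.etaleEquiv uniformSplitting_holds h36 hcoh hS).functor ⋙
          (Over.postEquiv (⟨S, hS⟩ : BTempCat 𝒢) c.equiv).functor ⋙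
          BTemp.fibreFamily (c.equiv.functor.obj ⟨S, hS⟩) ⋙
          Pi.eval (fun ω => BTemp (BTemp.stab (c.equiv.functor.obj ⟨S, hS⟩) (Quot.out ω))) ω₀ ≅
        BTemp.res φ))
    (v : 𝒢.graph.Vertex) (χ₀ : 𝒢.Gv v →ₜ* c.G) (hχ₀ : IsVerticialHom c v χ₀) :
    ∃ (ω : BTemp.Orbits (S.SV v)) (a : 𝒢.Gv v) (χ : 𝒢.Gv v →ₜ* c.G)
      (ψ : BTemp.stab (S.SV v) (Quot.out ω) →ₜ* BTemp.stab (c.equiv.functor.obj ⟨S, hS⟩) (Quot.out ω₀)),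
      (∀ b, χ b = χ₀ (a⁻¹ * b * a)) ∧
      (∀ h, ((ψ h : BTemp.stab (c.equiv.functor.obj ⟨S, hS⟩) (Quot.out ω₀)) : c.G) = χ (h : 𝒢.Gv v)) ∧
      (∀ b : 𝒢.Gv v, b ∈ BTemp.stab (S.SV v) (Quot.out ω) ↔
        χ b ∈ BTemp.stab (c.equiv.functor.obj ⟨S, hS⟩) (Quot.out ω₀)) ∧
      IsVerticialHom cS (⟨v, ω⟩ : S.coveringGraph.graph.Vertex) (φ.comp ψ) := by
  obtain ⟨ω, a, χ, k, hχ, hk⟩ := S.exists_isVerticialHom_normalised c hS ω₀ v χ₀ hχ₀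
  obtain ⟨ψ, hψ, hiff, ⟨i⟩⟩ := S.exists_ptFibre_compat c hS ω₀ v ω χ k hk
  obtain ⟨iφ⟩ := hφ
  refine ⟨ω, a, χ, ψ, hχ, hψ, hiff, ⟨?_⟩⟩
  let X : BTemp c.G := c.equiv.functor.obj ⟨S, hS⟩
  let et := S.etaleEquiv uniformSplitting_holds h36 hcoh hS
  let R : BTempCat S.coveringGraph ⥤ BTemp (BTemp.stab (S.SV v) (Quot.out ω)) :=
    ObjectProperty.ι _ ⋙ restrictV S.coveringGraph (⟨v, ω⟩ : S.coveringGraph.graph.Vertex)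
  let F₁ := Over.post (X := (⟨S, hS⟩ : BTempCat 𝒢)) (ObjectProperty.ι _ ⋙ restrictV 𝒢 v) ⋙
    BTemp.fibreFamily (S.SV v) ⋙ Pi.eval (fun ω' => BTemp (BTemp.stab (S.SV v) (Quot.out ω'))) ω
  let F₂ := (Over.postEquiv (⟨S, hS⟩ : BTempCat 𝒢) c.equiv).functor ⋙ BTemp.fibreFamily X ⋙
    Pi.eval (fun ω' => BTemp (BTemp.stab X (Quot.out ω'))) ω₀
  -- `R ≅ et.functor ⋙ F₁` (unit of the étale equivalence + the definitional identification)
  let i1 : R ≅ et.functor ⋙ F₁ :=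
    (Functor.isoWhiskerRight et.unitIso R : 𝟭 _ ⋙ R ≅ (et.functor ⋙ et.inverse) ⋙ R)
  -- `F₁ ≅ F₂ ⋙ B^temp(ψ)` is `i`
  let i2 : et.functor ⋙ F₁ ≅ et.functor ⋙ F₂ ⋙ BTemp.res ψ := Functor.isoWhiskerLeft et.functor i
  let i3 : cS.equiv.inverse ⋙ R ≅ (cS.equiv.inverse ⋙ et.functor ⋙ F₂) ⋙ BTemp.res ψ :=
    Functor.isoWhiskerLeft cS.equiv.inverse (i1 ≪≫ i2)
  exact i3 ≪≫ (Functor.isoWhiskerRight iφ (BTemp.res ψ) :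
    (cS.equiv.inverse ⋙ et.functor ⋙ F₂) ⋙ BTemp.res ψ ≅ BTemp.res φ ⋙ BTemp.res ψ)

end CovObj
end ProfiniteSemiGraph
end Literature.AnabelianGeometry.SemiGraphs
end
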